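import Literature.MathematicalPhysics.QuantumLattice.ComplexSourceCumulantBound
import Literature.MathematicalPhysics.QuantumLattice.DWaveSourceFreeCumulantBound

/-!
# Crux `TwSourcedCondensation` (item `stmt-HubbardSuperconductivity-1697`), line
# `zero-source-pair-cumulants`: the bridge (K_c) ⇒ (A)

`--supports stmt-HubbardSuperconductivity-1697`; no definition is introduced.

The registered stub `stub_discSlack_of_pairCumulantComparison` of the skeleton of line
`zero-source-pair-cumulants` (crux `TwSourcedCondensation`, route `ThermalWedge`) is the BRIDGE from

**(K_c) the zero-source pair-field cumulant COMPARISON** — for `[μ₁,μ₂] ⊂ (-4,0)`,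
`∃ B ∀ η ∃ U₀ a K` such that for `0 < U ≤ U₀`, `1 ≤ β ≤ e^{a/U}`, `μ ∈ [μ₁,μ₂]`, eventually in `L`,

  `‖(m!)⁻¹[(log Z_L(U,·))⁽ᵐ⁾(0) − (log Z_L(0,·))⁽ᵐ⁾(0)]‖ ≤ (η log β + K)·βL²·(Bβ)ᵐ⁻²`  (`m ≥ 2`),

`Z_L(u,z) = tr e^{-β(hubbardTorusWith 2 L 1 u μ − z(Δ_d + Δ_d†))}` — to

**(A) the two-sided disc slack** (hypothesis 1 of `Theorems.twSourcedCondensation_of_engine`):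
`|[p̃_U(h) − p̃_0(h)] − [p̃_U(0) − p̃_0(0)]| ≤ (η log β + K) h²` for real `|h| ≤ κ/β`,
`p̃_u(h) = log Z_β(dWaveSourceTorus L u μ h)/(βL²)`.

It is pure complex analysis already in the tree:

* `twCondensation_norm_tsum_coeff_mul_pow_add_two_le` — geometric tail bound
  `‖Σₙ≥₂ cₙ zⁿ‖ ≤ A‖z‖²/(1 − B‖z‖)` for a coefficient sequence with `‖cₙ‖ ≤ A Bⁿ⁻²` (`n ≥ 2`);
* `twCondensation_log_norm_sub_eq_re_tsum` — for an entire `Z` with `Z 0` in the slit plane,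
  `Z'(0) = 0` and geometrically bounded Taylor coefficients of `log ∘ Z`:
  `log ‖Z z‖ − log ‖Z 0‖ = Re Σₙ≥₂ aₙ zⁿ` on `B‖z‖ < 1`
  (`Literature.Analysis.Complex.eqOn_cexp_tsum_of_taylor_bound`, `tsum_taylorCoeff_eq_add`);
* `twCondensation_abs_log_norm_slack_le` — for TWO such functions `Z₁, Z₂` with a DIFFERENCE bound
  `‖(n!)⁻¹[(log∘Z₁)⁽ⁿ⁾(0) − (log∘Z₂)⁽ⁿ⁾(0)]‖ ≤ A' Bⁿ⁻²`:
  `|(log ‖Z₁ z‖ − log ‖Z₂ z‖) − (log ‖Z₁ 0‖ − log ‖Z₂ 0‖)| ≤ A'‖z‖²/(1 − B‖z‖)`;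
* `dWaveSource_abs_discSlack_le_of_cumulantComparison` — the torus corollary: the free absolute
  bound (`A₂, B₂`) and the comparison bound (`A', B'`) give, for `(B₂ + B')|s| ≤ 1/2`,
  `|[p̃_U(s) − p̃_0(s)] − [p̃_U(0) − p̃_0(0)]| ≤ 2A' s²/(βL²)` (the interacting absolute bound follows
  by the triangle inequality; evenness in the source, `partitionFn_hubbardTorusWith_sub_neg_smul_pairSource`,
  kills the linear Taylor term);
* `stub_discSlack_of_pairCumulantComparison` — **(K_c) ⇒ (A)** verbatim, with the free certificate
  `dWaveSource_free_pairCumulantBound` (`A₀, B₀`), `κ := 1/(2(B + B₀))`, `K ↦ 2K` at `η/2`.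

Sources: D. Ruelle, *Statistical Mechanics: Rigorous Results* (1969), §4.4 (analyticity of the
pressure from zero-freeness, Taylor control of `log Z`); E. C. Titchmarsh, *The Theory of Functions*
(1939), §4.1 (continuation by power series).
-/

noncomputable section

namespace Summit.HubbardSuperconductivity.HubbardSuperconductivity.Theorems

open scoped Nat
open Matrix Complex Literature.MathematicalPhysics.QuantumLattice Literature.Probability.LatticeModels

/-! ### Abstract complex analysis: two entire functions with comparable `log`-Taylor coefficients -/

/-- Geometric tail bound for a general coefficient sequence: if `‖cₙ‖ ≤ A Bⁿ⁻²` for `n ≥ 2`, then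
for `B‖z‖ < 1` the tail `Σₙ≥₂ cₙ zⁿ` is summable with `‖Σₙ≥₂ cₙ zⁿ‖ ≤ A‖z‖²/(1 − B‖z‖)`. [folklore] -/
theorem twCondensation_norm_tsum_coeff_mul_pow_add_two_le {c : ℕ → ℂ} {A B : ℝ} (hB : 0 ≤ B)
    (hK : ∀ n : ℕ, 2 ≤ n → ‖c n‖ ≤ A * B ^ (n - 2)) {z : ℂ} (hz : B * ‖z‖ < 1) :
    (Summable fun n : ℕ => c (n + 2) * z ^ (n + 2)) ∧
      ‖∑' n : ℕ, c (n + 2) * z ^ (n + 2)‖ ≤ A * ‖z‖ ^ 2 / (1 - B * ‖z‖) := by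
  have hq0 : 0 ≤ B * ‖z‖ := mul_nonneg hB (norm_nonneg _)
  have hgeo : HasSum (fun n : ℕ => A * ‖z‖ ^ 2 * (B * ‖z‖) ^ n) (A * ‖z‖ ^ 2 / (1 - B * ‖z‖)) := by
    rw [div_eq_mul_inv]
    exact (hasSum_geometric_of_lt_one hq0 hz).mul_left _
  have hle : ∀ n : ℕ, ‖c (n + 2) * z ^ (n + 2)‖ ≤ A * ‖z‖ ^ 2 * (B * ‖z‖) ^ n := fun n => by
    have h := hK (n + 2) (by omega)
    simp only [Nat.add_sub_cancel] at h
    rw [norm_mul, norm_pow]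
    calc ‖c (n + 2)‖ * ‖z‖ ^ (n + 2) ≤ A * B ^ n * ‖z‖ ^ (n + 2) :=
          mul_le_mul_of_nonneg_right h (pow_nonneg (norm_nonneg z) (n + 2))
      _ = A * ‖z‖ ^ 2 * (B * ‖z‖) ^ n := by ring
  have hsum : Summable fun n : ℕ => ‖c (n + 2) * z ^ (n + 2)‖ :=
    Summable.of_nonneg_of_le (fun n => norm_nonneg _) hle hgeo.summable
  refine ⟨Summable.of_norm hsum, ?_⟩
  calc _ ≤ ∑' n : ℕ, ‖c (n + 2) * z ^ (n + 2)‖ := norm_tsum_le_tsum_norm hsum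
    _ ≤ ∑' n : ℕ, A * ‖z‖ ^ 2 * (B * ‖z‖) ^ n := hsum.tsum_le_tsum hle hgeo.summable
    _ = A * ‖z‖ ^ 2 / (1 - B * ‖z‖) := hgeo.tsum_eq

/-- **`log ‖Z‖` is the real part of the Taylor tail.** Let `Z` be entire with `Z 0` in the slit
plane, `Z'(0) = 0`, and Taylor coefficients `aₙ = (n!)⁻¹(log ∘ Z)⁽ⁿ⁾(0)` bounded by `‖aₙ‖ ≤ A Bⁿ⁻²`
for `n ≥ 2`. Then for `B‖z‖ < 1`: `log ‖Z z‖ − log ‖Z 0‖ = Re Σₙ≥₂ aₙ zⁿ` (the Taylor series continues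
`log Z` to the disc and exponentiates to `Z`; the linear term is absent). [cite: Ruelle1969, §4.4] -/
theorem twCondensation_log_norm_sub_eq_re_tsum {Z : ℂ → ℂ} {A B : ℝ} (hZ : Differentiable ℂ Z)
    (h0 : Z 0 ∈ slitPlane) (h1 : deriv Z 0 = 0) (hA : 0 ≤ A) (hB : 0 ≤ B)
    (hK : ∀ n : ℕ, 2 ≤ n →
      ‖((n ! : ℂ))⁻¹ * iteratedDeriv n (fun w => log (Z w)) 0‖ ≤ A * B ^ (n - 2))
    {z : ℂ} (hz : B * ‖z‖ < 1) :
    Real.log ‖Z z‖ - Real.log ‖Z 0‖ =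
      (∑' n : ℕ, (((n + 2) ! : ℂ))⁻¹ * iteratedDeriv (n + 2) (fun w => log (Z w)) 0 *
        z ^ (n + 2)).re := by
  set F : ℂ → ℂ := fun w => log (Z w) with hFdef
  obtain ⟨r, hzr, hBr⟩ := exists_norm_lt_and_mul_lt_one hB hz
  have hr : 0 < r := lt_of_le_of_lt (norm_nonneg z) hzr
  have hexp := Literature.Analysis.Complex.eqOn_cexp_tsum_of_taylor_bound hZ h0 hA hB hK hr hBr
    (mem_ball_zero_iff.mpr hzr)
  simp only at hexp
  have hlogz : Real.log ‖Z z‖ =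
      (∑' n : ℕ, ((n ! : ℂ))⁻¹ * iteratedDeriv n F 0 * z ^ n).re := by
    rw [← hexp, norm_exp, Real.log_exp]
  have hlog0 : Real.log ‖Z 0‖ = (F 0).re := by
    simp only [hFdef, log_re]
  have hd : deriv F 0 = 0 := Literature.Analysis.Complex.deriv_clog_comp_eq_zero hZ h0 h1
  rw [hlogz, hlog0, Literature.Analysis.Complex.tsum_taylorCoeff_eq_add F hA hB hK hz, hd]
  simp only [zero_mul, add_zero, add_re]
  ring

/-- A three-term triangle inequality for normalised coefficients:
`‖c X‖ ≤ ‖c (X − Y)‖ + ‖c Y‖`. [folklore] -/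
theorem twCondensation_norm_mul_le (c X Y : ℂ) : ‖c * X‖ ≤ ‖c * (X - Y)‖ + ‖c * Y‖ := by
  have e : c * X = c * (X - Y) + c * Y := by ring
  rw [e]
  exact norm_add_le _ _

/-- **Two-function form of the Taylor control of `log ‖Z‖`.** Let `Z₁, Z₂` be entire with `Zᵢ 0` in
the slit plane and `Zᵢ'(0) = 0`, let the Taylor coefficients of `log ∘ Zᵢ` at `0` obey
`‖(n!)⁻¹(log ∘ Zᵢ)⁽ⁿ⁾(0)‖ ≤ Aᵢ Bⁿ⁻²` and their DIFFERENCE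
`‖(n!)⁻¹[(log ∘ Z₁)⁽ⁿ⁾(0) − (log ∘ Z₂)⁽ⁿ⁾(0)]‖ ≤ A' Bⁿ⁻²` for `n ≥ 2`. Then for `B‖z‖ < 1`:
`|(log ‖Z₁ z‖ − log ‖Z₂ z‖) − (log ‖Z₁ 0‖ − log ‖Z₂ 0‖)| ≤ A'‖z‖²/(1 − B‖z‖)`.
[cite: Ruelle1969, §4.4] -/
theorem twCondensation_abs_log_norm_slack_le {Z₁ Z₂ : ℂ → ℂ} {A₁ A₂ A' B : ℝ}
    (hZ₁ : Differentiable ℂ Z₁) (hZ₂ : Differentiable ℂ Z₂)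
    (h0₁ : Z₁ 0 ∈ slitPlane) (h0₂ : Z₂ 0 ∈ slitPlane)
    (h1₁ : deriv Z₁ 0 = 0) (h1₂ : deriv Z₂ 0 = 0)
    (hA₁ : 0 ≤ A₁) (hA₂ : 0 ≤ A₂) (hB : 0 ≤ B)
    (hK₁ : ∀ n : ℕ, 2 ≤ n →
      ‖((n ! : ℂ))⁻¹ * iteratedDeriv n (fun w => log (Z₁ w)) 0‖ ≤ A₁ * B ^ (n - 2))
    (hK₂ : ∀ n : ℕ, 2 ≤ n →
      ‖((n ! : ℂ))⁻¹ * iteratedDeriv n (fun w => log (Z₂ w)) 0‖ ≤ A₂ * B ^ (n - 2))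
    (hK : ∀ n : ℕ, 2 ≤ n →
      ‖((n ! : ℂ))⁻¹ * (iteratedDeriv n (fun w => log (Z₁ w)) 0 -
        iteratedDeriv n (fun w => log (Z₂ w)) 0)‖ ≤ A' * B ^ (n - 2))
    {z : ℂ} (hz : B * ‖z‖ < 1) :
    |(Real.log ‖Z₁ z‖ - Real.log ‖Z₂ z‖) - (Real.log ‖Z₁ 0‖ - Real.log ‖Z₂ 0‖)| ≤
      A' * ‖z‖ ^ 2 / (1 - B * ‖z‖) := by
  set F₁ : ℂ → ℂ := fun w => log (Z₁ w) with hF₁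
  set F₂ : ℂ → ℂ := fun w => log (Z₂ w) with hF₂
  rw [show ∀ a b c d : ℝ, (a - b) - (c - d) = (a - c) - (b - d) from fun a b c d => by ring,
    twCondensation_log_norm_sub_eq_re_tsum hZ₁ h0₁ h1₁ hA₁ hB hK₁ hz,
    twCondensation_log_norm_sub_eq_re_tsum hZ₂ h0₂ h1₂ hA₂ hB hK₂ hz, ← sub_re]
  have hs₁ : Summable fun n : ℕ =>
      (((n + 2) ! : ℂ))⁻¹ * iteratedDeriv (n + 2) F₁ 0 * z ^ (n + 2) :=
    (twCondensation_norm_tsum_coeff_mul_pow_add_two_le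
      (c := fun n => ((n ! : ℂ))⁻¹ * iteratedDeriv n F₁ 0) hB hK₁ hz).1
  have hs₂ : Summable fun n : ℕ =>
      (((n + 2) ! : ℂ))⁻¹ * iteratedDeriv (n + 2) F₂ 0 * z ^ (n + 2) :=
    (twCondensation_norm_tsum_coeff_mul_pow_add_two_le
      (c := fun n => ((n ! : ℂ))⁻¹ * iteratedDeriv n F₂ 0) hB hK₂ hz).1
  have hdiff : ‖∑' n : ℕ, ((((n + 2) ! : ℂ))⁻¹ *
      (iteratedDeriv (n + 2) F₁ 0 - iteratedDeriv (n + 2) F₂ 0)) * z ^ (n + 2)‖ ≤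
      A' * ‖z‖ ^ 2 / (1 - B * ‖z‖) :=
    (twCondensation_norm_tsum_coeff_mul_pow_add_two_le
      (c := fun n => ((n ! : ℂ))⁻¹ * (iteratedDeriv n F₁ 0 - iteratedDeriv n F₂ 0)) hB hK hz).2
  rw [← hs₁.tsum_sub hs₂]
  have heq : (∑' n : ℕ, ((((n + 2) ! : ℂ))⁻¹ * iteratedDeriv (n + 2) F₁ 0 * z ^ (n + 2) -
      (((n + 2) ! : ℂ))⁻¹ * iteratedDeriv (n + 2) F₂ 0 * z ^ (n + 2))) =
      ∑' n : ℕ, ((((n + 2) ! : ℂ))⁻¹ *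
        (iteratedDeriv (n + 2) F₁ 0 - iteratedDeriv (n + 2) F₂ 0)) * z ^ (n + 2) :=
    tsum_congr fun n => by ring
  rw [heq]
  exact (abs_re_le_norm _).trans hdiff

/-! ### The `d`-wave–sourced Hubbard torus -/

/-- **Disc slack of the torus from the cumulant comparison.** Let
`Z_L(u,z) = tr e^{-β(hubbardTorusWith 2 L 1 u μ − z(Δ_d + Δ_d†))}` (`u = U, 0`; even in `z` by the
gauge rotation). If the free Taylor coefficients obey `‖(m!)⁻¹(log Z_L(0,·))⁽ᵐ⁾(0)‖ ≤ A₂ B₂ᵐ⁻²` and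
the comparison `‖(m!)⁻¹[(log Z_L(U,·))⁽ᵐ⁾(0) − (log Z_L(0,·))⁽ᵐ⁾(0)]‖ ≤ A' B'ᵐ⁻²` holds for `m ≥ 2`,
then for every real `s` with `(B₂ + B')|s| ≤ 1/2`, `p̃_u(s) = log Z_β(dWaveSourceTorus L u μ s)/(βL²)`:
`|[p̃_U(s) − p̃_0(s)] − [p̃_U(0) − p̃_0(0)]| ≤ 2A' s²/(βL²)`. [cite: Ruelle1969, §4.4] -/
theorem dWaveSource_abs_discSlack_le_of_cumulantComparison (L : ℕ) [NeZero L] {β : ℝ}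
    (hβ : 0 < β) (U μ : ℝ) {A₂ B₂ A' B' : ℝ} (hA₂ : 0 ≤ A₂) (hB₂ : 0 ≤ B₂) (hA' : 0 ≤ A')
    (hB' : 0 ≤ B')
    (hK₂ : ∀ m : ℕ, 2 ≤ m →
      ‖((m ! : ℂ))⁻¹ * iteratedDeriv m (fun z : ℂ => log (partitionFn β (hubbardTorusWith 2 L 1 0 μ -
        z • (pairField dWaveFormFactor L + (pairField dWaveFormFactor L)ᴴ)))) 0‖ ≤
        A₂ * B₂ ^ (m - 2))
    (hK : ∀ m : ℕ, 2 ≤ m →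
      ‖((m ! : ℂ))⁻¹ * (iteratedDeriv m (fun z : ℂ => log (partitionFn β
          (hubbardTorusWith 2 L 1 U μ -
            z • (pairField dWaveFormFactor L + (pairField dWaveFormFactor L)ᴴ)))) 0 -
        iteratedDeriv m (fun z : ℂ => log (partitionFn β (hubbardTorusWith 2 L 1 0 μ -
          z • (pairField dWaveFormFactor L + (pairField dWaveFormFactor L)ᴴ)))) 0)‖ ≤
        A' * B' ^ (m - 2))
    {s : ℝ} (hs : (B₂ + B') * |s| ≤ 1 / 2) :
    |(Real.log (partitionFn β (dWaveSourceTorus L U μ s)).re / (β * (L : ℝ) ^ 2) -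
        Real.log (partitionFn β (dWaveSourceTorus L 0 μ s)).re / (β * (L : ℝ) ^ 2)) -
      (Real.log (partitionFn β (dWaveSourceTorus L U μ 0)).re / (β * (L : ℝ) ^ 2) -
        Real.log (partitionFn β (dWaveSourceTorus L 0 μ 0)).re / (β * (L : ℝ) ^ 2))| ≤
      2 * A' * s ^ 2 / (β * (L : ℝ) ^ 2) := by
  set Q := pairField dWaveFormFactor L + (pairField dWaveFormFactor L)ᴴ with hQ
  set H₁ := hubbardTorusWith 2 L 1 U μ with hH₁
  set H₂ := hubbardTorusWith 2 L 1 0 μ with hH₂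
  set Z₁ : ℂ → ℂ := fun z => partitionFn β (H₁ - z • Q) with hZ₁
  set Z₂ : ℂ → ℂ := fun z => partitionFn β (H₂ - z • Q) with hZ₂
  have hH₁h : H₁.IsHermitian := isHermitian_hamiltonianWith (fermionTorusGraph 2 L) 1 U μ
  have hH₂h : H₂.IsHermitian := isHermitian_hamiltonianWith (fermionTorusGraph 2 L) 1 0 μ
  have hQh : Q.IsHermitian := isHermitian_pairField_add_conjTranspose L
  have hZ₁d : Differentiable ℂ Z₁ := differentiable_partitionFn_sub_smul β H₁ Q
  have hZ₂d : Differentiable ℂ Z₂ := differentiable_partitionFn_sub_smul β H₂ Q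
  have hZ₁0 : Z₁ 0 = partitionFn β H₁ := by simp [hZ₁]
  have hZ₂0 : Z₂ 0 = partitionFn β H₂ := by simp [hZ₂]
  have h0₁ : Z₁ 0 ∈ slitPlane := by
    rw [hZ₁0]; exact partitionFn_mem_slitPlane β hH₁h
  have h0₂ : Z₂ 0 ∈ slitPlane := by
    rw [hZ₂0]; exact partitionFn_mem_slitPlane β hH₂h
  have h1₁ : deriv Z₁ 0 = 0 := deriv_partitionFn_sub_smul_eq_zero_of_even β H₁ Q
    (partitionFn_hubbardTorusWith_sub_neg_smul_pairSource L β U μ)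
  have h1₂ : deriv Z₂ 0 = 0 := deriv_partitionFn_sub_smul_eq_zero_of_even β H₂ Q
    (partitionFn_hubbardTorusWith_sub_neg_smul_pairSource L β 0 μ)
  -- a common geometric ratio `B₂ + B'`
  have hB : 0 ≤ B₂ + B' := add_nonneg hB₂ hB'
  have hK₂' : ∀ m : ℕ, 2 ≤ m →
      ‖((m ! : ℂ))⁻¹ * iteratedDeriv m (fun w => log (Z₂ w)) 0‖ ≤ A₂ * (B₂ + B') ^ (m - 2) :=
    fun m hm => (hK₂ m hm).trans (mul_le_mul_of_nonneg_left
      (pow_le_pow_left₀ hB₂ (le_add_of_nonneg_right hB') _) hA₂)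
  have hK' : ∀ m : ℕ, 2 ≤ m →
      ‖((m ! : ℂ))⁻¹ * (iteratedDeriv m (fun w => log (Z₁ w)) 0 -
        iteratedDeriv m (fun w => log (Z₂ w)) 0)‖ ≤ A' * (B₂ + B') ^ (m - 2) :=
    fun m hm => (hK m hm).trans (mul_le_mul_of_nonneg_left
      (pow_le_pow_left₀ hB' (le_add_of_nonneg_left hB₂) _) hA')
  have hK₁' : ∀ m : ℕ, 2 ≤ m →
      ‖((m ! : ℂ))⁻¹ * iteratedDeriv m (fun w => log (Z₁ w)) 0‖ ≤ (A' + A₂) * (B₂ + B') ^ (m - 2) :=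
    fun m hm => by
      rw [add_mul]
      exact (twCondensation_norm_mul_le _ _ _).trans (add_le_add (hK' m hm) (hK₂' m hm))
  have hs1 : (B₂ + B') * ‖(s : ℂ)‖ < 1 := by
    rw [Complex.norm_real, Real.norm_eq_abs]; linarith
  have hmain := twCondensation_abs_log_norm_slack_le hZ₁d hZ₂d h0₁ h0₂ h1₁ h1₂ (add_nonneg hA' hA₂)
    hA₂ hB hK₁' hK₂' hK' hs1
  -- identify the norms with the (positive) partition functions
  have hn₁ : ‖Z₁ (s : ℂ)‖ = (partitionFn β (H₁ - (s : ℂ) • Q)).re :=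
    norm_eq_re_of_pos (Matrix.partitionFn_pos β (hH₁h.sub (isHermitian_real_smul hQh s)))
  have hn₂ : ‖Z₂ (s : ℂ)‖ = (partitionFn β (H₂ - (s : ℂ) • Q)).re :=
    norm_eq_re_of_pos (Matrix.partitionFn_pos β (hH₂h.sub (isHermitian_real_smul hQh s)))
  have hn₁0 : ‖Z₁ 0‖ = (partitionFn β H₁).re := by
    rw [hZ₁0]; exact norm_eq_re_of_pos (Matrix.partitionFn_pos β hH₁h)
  have hn₂0 : ‖Z₂ 0‖ = (partitionFn β H₂).re := by
    rw [hZ₂0]; exact norm_eq_re_of_pos (Matrix.partitionFn_pos β hH₂h)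
  rw [hn₁, hn₂, hn₁0, hn₂0, Complex.norm_real, Real.norm_eq_abs, sq_abs] at hmain
  have hmain2 : |(Real.log (partitionFn β (H₁ - (s : ℂ) • Q)).re -
      Real.log (partitionFn β (H₂ - (s : ℂ) • Q)).re) -
      (Real.log (partitionFn β H₁).re - Real.log (partitionFn β H₂).re)| ≤ 2 * A' * s ^ 2 := by
    refine hmain.trans ?_
    rw [div_le_iff₀ (by linarith)]
    have : 0 ≤ A' * s ^ 2 := by positivity
    nlinarith
  have h0U : dWaveSourceTorus L U μ 0 = H₁ := dWaveSourceTorus_zero L U μ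
  have h00 : dWaveSourceTorus L 0 μ 0 = H₂ := dWaveSourceTorus_zero L 0 μ
  have hsU : dWaveSourceTorus L U μ s = H₁ - (s : ℂ) • Q := rfl
  have hs0 : dWaveSourceTorus L 0 μ s = H₂ - (s : ℂ) • Q := rfl
  rw [h0U, h00, hsU, hs0]
  have hL : (0 : ℝ) < (L : ℝ) ^ 2 := by
    have : (0 : ℝ) < L := Nat.cast_pos.2 (Nat.pos_of_ne_zero (NeZero.ne L))
    positivity
  have hβL : 0 < β * (L : ℝ) ^ 2 := mul_pos hβ hL
  rw [← sub_div, ← sub_div, ← sub_div, abs_div, abs_of_pos hβL, div_le_div_iff_of_pos_right hβL]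
  exact hmain2

/-! ### The registered stub -/

/-- **(K_c) ⇒ (A): the registered stub `stub_discSlack_of_pairCumulantComparison`** (verbatim
signature of the skeleton of line `zero-source-pair-cumulants` of crux `TwSourcedCondensation`): the
zero-source pair-field cumulant comparison of the weakly repulsive torus against the free one, in the
window `U log β ≤ a`, yields the two-sided disc slack
`|[p̃_U(h) − p̃_0(h)] − [p̃_U(0) − p̃_0(0)]| ≤ (η log β + K) h²` on `|h| ≤ κ/β` — by the free
certificate `dWaveSource_free_pairCumulantBound` (`A₀, B₀`), `κ = 1/(2(B + B₀))`, the comparison at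
`η/2` and `dWaveSource_abs_discSlack_le_of_cumulantComparison`. [cite: Ruelle1969, §4.4] -/
theorem stub_discSlack_of_pairCumulantComparison :
    (∀ μ₁ μ₂ : ℝ, -4 < μ₁ → μ₁ ≤ μ₂ → μ₂ < 0 → ∃ B : ℝ, 0 < B ∧ ∀ η : ℝ, 0 < η → ∃ U₀ a K : ℝ, 0 < U₀ ∧ 0 < a ∧ 0 < K ∧ ∀ U : ℝ, 0 < U → U ≤ U₀ → ∀ β : ℝ, 1 ≤ β → β ≤ Real.exp (a / U) → ∀ μ ∈ Set.Icc μ₁ μ₂, ∃ L₀ : ℕ, ∀ (L : ℕ) [NeZero L], L₀ ≤ L → ∀ m : ℕ, 2 ≤ m → ‖((Nat.factorial m : ℂ))⁻¹ * (iteratedDeriv m (fun z : ℂ => Complex.log (Matrix.partitionFn β (Literature.MathematicalPhysics.QuantumLattice.hubbardTorusWith 2 L 1 U μ - z • (Literature.MathematicalPhysics.QuantumLattice.pairField Literature.MathematicalPhysics.QuantumLattice.dWaveFormFactor L + (Literature.MathematicalPhysics.QuantumLattice.pairField Literature.MathematicalPhysics.QuantumLattice.dWaveFormFactor L)ᴴ))))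 0 - iteratedDeriv m (fun z : ℂ => Complex.log (Matrix.partitionFn β (Literature.MathematicalPhysics.QuantumLattice.hubbardTorusWith 2 L 1 0 μ - z • (Literature.MathematicalPhysics.QuantumLattice.pairField Literature.MathematicalPhysics.QuantumLattice.dWaveFormFactor L + (Literature.MathematicalPhysics.QuantumLattice.pairField Literature.MathematicalPhysics.QuantumLattice.dWaveFormFactor L)ᴴ)))) 0)‖ ≤ (η * Real.log β + K) * (β * (L : ℝ) ^ 2) * (B * β) ^ (m - 2)) →
    (∀ μ₁ μ₂ : ℝ, -4 < μ₁ → μ₁ ≤ μ₂ → μ₂ < 0 → ∃ κ : ℝ, 0 < κ ∧ ∀ η : ℝ, 0 < η → ∃ U₀ a K : ℝ, 0 < U₀ ∧ 0 < a ∧ 0 < K ∧ ∀ U : ℝ, 0 < U → U ≤ U₀ → ∀ β : ℝ, 1 ≤ β → β ≤ Real.exp (a / U) → ∀ μ ∈ Set.Icc μ₁ μ₂, ∃ L₀ : ℕ, ∀ (L : ℕ) [NeZero L], L₀ ≤ L → ∀ h : ℝ, |h| ≤ κ / β → |(Real.log (Matrix.partitionFn β (Literature.MathematicalPhysics.QuantumLattice.dWaveSourceTorus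 L U μ h)).re / (β * (L : ℝ) ^ 2) - Real.log (Matrix.partitionFn β (Literature.MathematicalPhysics.QuantumLattice.dWaveSourceTorus L 0 μ h)).re / (β * (L : ℝ) ^ 2)) - (Real.log (Matrix.partitionFn β (Literature.MathematicalPhysics.QuantumLattice.dWaveSourceTorus L U μ 0)).re / (β * (L : ℝ) ^ 2) - Real.log (Matrix.partitionFn β (Literature.MathematicalPhysics.QuantumLattice.dWaveSourceTorus L 0 μ 0)).re / (β * (L : ℝ) ^ 2))| ≤ (η * Real.log β + K) * h ^ 2) := by
  intro hK μ₁ μ₂ h4 h12 h0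
  obtain ⟨B, hB, hKη⟩ := hK μ₁ μ₂ h4 h12 h0
  obtain ⟨A₀, B₀, hA₀, hB₀, hfree⟩ := dWaveSource_free_pairCumulantBound μ₁ μ₂ h4 h12 h0
  refine ⟨1 / (2 * (B + B₀)), by positivity, fun η hη => ?_⟩
  obtain ⟨U₀, a, K, hU₀, ha, hKpos, hreg⟩ := hKη (η / 2) (by positivity)
  refine ⟨U₀, a, 2 * K, hU₀, ha, by positivity, ?_⟩
  intro U hU hUle β hβ1 hβa μ hμ
  obtain ⟨L₁, hL₁⟩ := hreg U hU hUle β hβ1 hβa μ hμ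
  obtain ⟨L₂, hL₂⟩ := hfree β hβ1 μ hμ
  refine ⟨max L₁ L₂, fun L _ hL h hh => ?_⟩
  have hβ : 0 < β := by linarith
  have hlog : 0 ≤ Real.log β := Real.log_nonneg hβ1
  have hL2 : (0 : ℝ) < (L : ℝ) ^ 2 := by
    have : (0 : ℝ) < L := Nat.cast_pos.2 (Nat.pos_of_ne_zero (NeZero.ne L))
    positivity
  have hβL : 0 < β * (L : ℝ) ^ 2 := mul_pos hβ hL2
  have hA₂ : 0 ≤ A₀ * (1 + Real.log β) * (β * (L : ℝ) ^ 2) := by positivity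
  have hB₂ : 0 ≤ B₀ * β := by positivity
  have hA' : 0 ≤ (η / 2 * Real.log β + K) * (β * (L : ℝ) ^ 2) := by positivity
  have hB' : 0 ≤ B * β := by positivity
  have hs : (B₀ * β + B * β) * |h| ≤ 1 / 2 := by
    rw [le_div_iff₀ hβ] at hh
    have e : (B₀ * β + B * β) * |h| = (B + B₀) * (|h| * β) := by ring
    rw [e]
    calc (B + B₀) * (|h| * β) ≤ (B + B₀) * (1 / (2 * (B + B₀))) :=
          mul_le_mul_of_nonneg_left hh (by positivity)
      _ = 1 / 2 := by field_simp
  have key := dWaveSource_abs_discSlack_le_of_cumulantComparison L hβ U μ hA₂ hB₂ hA' hB'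
    (hL₂ L (le_of_max_le_right hL)) (hL₁ L (le_of_max_le_left hL)) hs
  refine key.trans (le_of_eq ?_)
  rw [div_eq_iff hβL.ne']
  ring

end Summit.HubbardSuperconductivity.HubbardSuperconductivity.Theorems
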